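import Summits.ValiantsHypothesis.ValiantsHypothesis.Theorems.LacunarySymmetroidMatrixDescartesDefectInterpolation
import Summits.ValiantsHypothesis.ValiantsHypothesis.Theorems.LacunarySymmetroidMatrixDescartesDefectLawPencil

/-!
# `MatrixDescartes` (stmt-ValiantsHypothesis-18050, V1) — line «defect» ported (F4): STUB 1 closed by name, the LINEAR
# excess law, the pencil interpolation law, the twelve interpolation ROWS `(2,K)` and the positive `NearFullHeightRow` table

HONEST FRAMING.  Helper port (`--supports stmt-ValiantsHypothesis-18050 --as helper`; val-lit port pool, seat val-port-3 g0;
val-lit desk RULING #232 (d)) of §8 (tail), §9 and §10 of the crux workfile `Cruxes/MatrixDescartes/Lines/defect.lean` v2.1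
(val-idea-6 g4, LINE 3 «defect»; val-idea-crit-1 VERDICT #25 = PASS, structure + instrument tier, 0 provers; the critic
re-derived every row exactly), token-for-token up to the port notes: namespace `…Theorems.…Defect`; the pigeonhole rows
`defectRow_*`, `l1_det_pencil_le` from val-port-1's (F2) `…LacunarySymmetroidMatrixDescartesDefectLawPencil`, the `Prop`s
`InterpolationDefectLaw` / `NearFullHeightRow` from (DD) `…LacunarySymmetroidMatrixDescartesDefectDefs`, the law
`interpolationDefectLaw` from (F3), and `l1_nonneg` / `l1_det_pencil_le` from val-port-4's
`…RangeObligations` (§9 of «range») — all CITED BY NAME; `pencil` / `l1` are `…FiniteSectorDefs.pencil` /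
`…FiniteSectorHeightDefs.l1`.  INTERFACE DELTA forced by that dedup (val-port-1 l.7431 of the val-lit bus): the tree's
`l1_det_pencil_le` carries no `0 ≤ h` hypothesis, so `pencilInterpolationLaw` and `irow2` DROP the workfile's idle binders
`(hh : 0 ≤ h)` / `(hH : 0 ≤ H)` (the twelve `irow_*` keep their signatures token-for-token, one `norm_num` fewer inside).  No definitions, no named facts, nothing admitted.  Instrument rows on the NEAR-FULL sector
(height-sensitive); each row is a closed theorem `… → False` by `norm_num` on an exact rational certificate; nothing here
bounds the crux `…Theses.LacunarySymmetroid.MatrixDescartes`, touches Conjecture B, or moves `VP ≠ VNP`.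

CONTENTS.  `interpolationDefectLaw_holds : InterpolationDefectLaw` (STUB 1 of the line, closed); `excessLawLinear`
(`φ = π/2`: `√|c₀·lc| · √2^Z · D!/(D^D(D+1)) ≤ ‖f‖₁`, i.e. `Z ≤ 2log₂R + 2.89·D + 2log₂(D+1)`); `pencilInterpolationLaw`
(right side `m!(Kh)^m` for letters `≤ h`); the rational minorant `irow_core` (`cos(φ/2) ≥ 1 − φ²/8`, `π ≤ 3.1416`) and the
generic `2×2` row `irow2`; the rows (ends integer-normalised `|c₀·lc| ≥ 1`, `Z` distinct positive roots, degree `Z + D`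
⇒ minimal admissible integer height `H + 1`):
`(2,8)`, `Z = 26`: `D = 3 ⇒ H ≥ 23 · 4 ⇒ ≥ 9 · 5 ⇒ ≥ 4 · 6 ⇒ ≥ 2`;  `(2,9)`, `Z = 32`:
`D = 3 ⇒ ≥ 138 · 4 ⇒ ≥ 51 · 5 ⇒ ≥ 21 · 6 ⇒ ≥ 9 · 7 ⇒ ≥ 4 · 8 ⇒ ≥ 2`;  `(2,7)`, `Z = 20`: `D = 3 ⇒ ≥ 4 · 4 ⇒ ≥ 2`;
and §10, the positive packaging `nearFullHeightRow_K_Z_D : NearFullHeightRow K Z D H` of the best row per cell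
(`(2,8)`: `D = 1…6 ↦ H = 292, 84, 22, 8, 3, 1`; `(2,9)`: `D = 1…8 ↦ 1980, 542, 137, 50, 20, 8, 3, 1`; `(2,7)`: `D = 1…4 ↦
44, 13, 3, 1`; `(2,6)`: `D = 1, 2 ↦ 13, 4`) with `nearFullHeightRow_mono`, citable by name (crit-1 #25 port note).
READING FOR THE ENGINES (26-hunt, STAMP searches): a `2×2` integer pencil on 8 letters with 26 distinct positive roots and
entries `≤ 3` has degree `≥ 32`; entries `≤ 8` ⇒ `≥ 31`; entries `≤ 22` ⇒ `≥ 30`.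
[folklore] Taylor/Jordan minorants; the certificates are the line's data (val-idea-6 g4), re-derived by val-idea-crit-1.
-/


-- `Summit.ValiantsHypothesis.ValiantsHypothesis.…` is the tree's mandated single-conjunct layout (Sub = Summit).
set_option linter.dupNamespace false

open Polynomial Finset

namespace Summit.ValiantsHypothesis.ValiantsHypothesis.Theorems.LacunarySymmetroidMatrixDescartes.Defect

open Summit.ValiantsHypothesis.ValiantsHypothesis.Theorems.LacunarySymmetroidMatrixDescartes.FiniteSector
  (pencil l1 Rrep)
open Summit.ValiantsHypothesis.ValiantsHypothesis.Theorems.LacunarySymmetroidMatrixDescartes.RangeObligations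
  (l1_nonneg l1_det_pencil_le)

/-- **STUB 1 CLOSED.** -/
theorem interpolationDefectLaw_holds : InterpolationDefectLaw := by
  intro f hf A hA D hD hD1 φ hφ0 hφ
  by_cases h0 : f.coeff 0 = 0
  · rw [h0, zero_mul, abs_zero, Real.sqrt_zero, zero_mul]
    exact l1_nonneg f
  · exact interpolationDefectLaw f hf h0 A (fun a ha => (hA a ha).1) (fun a ha => (hA a ha).2) hD hD1 hφ0 hφ

/-- **LINEAR EXCESS LAW (PROVED; `φ = π/2` in the interpolation law).**  For every real `f` with `f(0) ≠ 0`,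
`Z` distinct positive roots and defect `D ≥ 1`:  `√|c₀·lc| · √2^Z · D!/(D^D(D+1)) ≤ ‖f‖₁`, i.e.
`Z ≤ 2·log₂(‖f‖₁/√|c₀lc|) + 2·log₂(D^D(D+1)/D!) ≤ 2·log₂ R + 2.89·D + 2·log₂(D+1)`. -/
theorem excessLawLinear (f : ℝ[X]) (hf : f ≠ 0) (h0 : f.coeff 0 ≠ 0) (A : Finset ℝ) (hApos : ∀ a ∈ A, 0 < a)
    (hAroot : ∀ a ∈ A, f.IsRoot a) {D : ℕ} (hD : f.natDegree = A.card + D) (hD1 : 1 ≤ D) :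
    Real.sqrt |f.coeff 0 * f.leadingCoeff|
      * (Real.sqrt 2 ^ A.card * ((1 / D) ^ D * (D.factorial : ℝ) / (D + 1))) ≤ l1 f := by
  have hD' : (0 : ℝ) < D := by exact_mod_cast hD1
  have h := interpolationDefectLaw f hf h0 A hApos hAroot hD hD1 (φ := Real.pi / 2) (by positivity) le_rfl
  have hcos : 2 * Real.cos (Real.pi / 2 / 2) = Real.sqrt 2 := by
    rw [show Real.pi / 2 / 2 = Real.pi / 4 by ring, Real.cos_pi_div_four]; ring
  have hnode : 2 * (Real.pi / 2) / (Real.pi * D) = 1 / D := by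
    field_simp
  rw [hcos, hnode] at h
  exact h

/-! ## §9 The pencil form of the interpolation law and the LINEAR-IN-DEFECT rows (m = 2)

With §8 the refund per wasted root is `≈ log₂(eπ/2φ) ≈ 2.5–3.3` bits (instead of `≈ log₂ D + O(1)`), so rows
stay non-vacuous up to `D ≈ Z/4`.  Reading (integer letters, `E ≥ 1`; the §6 pigeonhole rows remain better at
`D ≤ 2`):  `(2,8)`, 26 positive roots: `D=3 ⇒ h ≥ 23 · D=4 ⇒ ≥ 9 · D=5 ⇒ ≥ 4 · D=6 ⇒ ≥ 2`;
`(2,9)`, 32 roots: `D=3 ⇒ ≥ 138 · 4 ⇒ ≥ 51 · 5 ⇒ ≥ 21 · 6 ⇒ ≥ 9 · 7 ⇒ ≥ 4 · 8 ⇒ ≥ 2`;  `(2,7)`, 20 roots: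
`D=3 ⇒ ≥ 4 · 4 ⇒ ≥ 2`.  Scale-free pre-filter (any engine, any normalisation):
`log₂(‖det P‖₁/√|c₀c_N|) ≥ Z·log₂(2cos(φ/2)) − D·log₂(πD/2φ) + log₂(D!/(D+1))`, e.g. `Z=26`: 16.0/13.3/10.8/8.4
bits at `D = 3/4/5/6`; `Z=32`: 21.6/18.7/16.1/13.6/11.2/8.9 at `D = 3…8`. -/

/-- **Pencil interpolation law.**  Letters `≤ h`, `det ≢ 0` with `c₀ ≠ 0`, `A` distinct positive roots of `det`, defect
`D = deg − |A| ≥ 1`: `√|c₀·lc| · (2cos(φ/2))^{|A|} · (2φ/(πD))^D · D!/(D+1) ≤ m!(Kh)^m` for all `0 < φ ≤ π/2`. -/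
theorem pencilInterpolationLaw {m K : ℕ} (d : Fin K → ℕ) (S : Fin K → Matrix (Fin m) (Fin m) ℝ) {h : ℝ}
    (hS : ∀ l i j, |S l i j| ≤ h) (hdet : (pencil d S).det ≠ 0) (h0 : (pencil d S).det.coeff 0 ≠ 0)
    (A : Finset ℝ) (hApos : ∀ a ∈ A, 0 < a) (hAroot : ∀ a ∈ A, (pencil d S).det.IsRoot a)
    {D : ℕ} (hD : (pencil d S).det.natDegree = A.card + D) (hD1 : 1 ≤ D)
    {φ : ℝ} (hφ0 : 0 < φ) (hφ : φ ≤ Real.pi / 2) :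
    Real.sqrt |(pencil d S).det.coeff 0 * (pencil d S).det.leadingCoeff|
      * ((2 * Real.cos (φ / 2)) ^ A.card * ((2 * φ / (Real.pi * D)) ^ D * (D.factorial : ℝ) / (D + 1)))
      ≤ (m.factorial : ℝ) * (K * h) ^ m :=
  (interpolationDefectLaw _ hdet h0 A hApos hAroot hD hD1 hφ0 hφ).trans (l1_det_pencil_le d S hS)

/-- Rational minorant of the interpolation law: `cos(φ/2) ≥ 1 − φ²/8`, `π ≤ 3.1416`. -/
theorem irow_core {Z D : ℕ} (hD1 : 1 ≤ D) {φ E R : ℝ} (hφ0 : 0 < φ) (hφ1 : φ ≤ 3 / 2) (hE : 1 ≤ E)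
    (hlaw : Real.sqrt E * ((2 * Real.cos (φ / 2)) ^ Z
      * ((2 * φ / (Real.pi * D)) ^ D * (D.factorial : ℝ) / (D + 1))) ≤ R) :
    (2 - φ ^ 2 / 4) ^ (2 * Z) * ((2 * φ / (3.1416 * D)) ^ D * (D.factorial : ℝ) / (D + 1)) ^ 2 ≤ R ^ 2 := by
  have hD' : (0 : ℝ) < D := by exact_mod_cast hD1
  set c := 2 - φ ^ 2 / 4 with hc
  have hc0 : 0 ≤ c := by rw [hc]; nlinarith
  have hcle : c ≤ 2 * Real.cos (φ / 2) := by
    have := Real.one_sub_sq_div_two_le_cos (x := φ / 2)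
    rw [hc]; nlinarith
  set q := (2 * φ / (3.1416 * D)) ^ D * (D.factorial : ℝ) / (D + 1) with hq
  have hq0 : 0 ≤ q := by positivity
  have hqle : q ≤ (2 * φ / (Real.pi * D)) ^ D * (D.factorial : ℝ) / (D + 1) := by
    have hπ : 2 * φ / (3.1416 * D) ≤ 2 * φ / (Real.pi * D) := by
      apply div_le_div_of_nonneg_left (by positivity) (by positivity)
      exact mul_le_mul_of_nonneg_right Real.pi_lt_d4.le hD'.le
    have h1 : (2 * φ / (3.1416 * D)) ^ D ≤ (2 * φ / (Real.pi * D)) ^ D := pow_le_pow_left₀ (by positivity) hπ D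
    rw [hq]
    apply div_le_div_of_nonneg_right _ (by positivity)
    exact mul_le_mul_of_nonneg_right h1 (by positivity)
  have hL0 : c ^ Z * q ≤ Real.sqrt E * ((2 * Real.cos (φ / 2)) ^ Z
      * ((2 * φ / (Real.pi * D)) ^ D * (D.factorial : ℝ) / (D + 1))) := by
    have h1 : c ^ Z ≤ (2 * Real.cos (φ / 2)) ^ Z := pow_le_pow_left₀ hc0 hcle Z
    have h3 : (1 : ℝ) ≤ Real.sqrt E := by
      rw [show (1 : ℝ) = Real.sqrt 1 by simp]; exact Real.sqrt_le_sqrt hE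
    have h4 : 0 ≤ (2 * Real.cos (φ / 2)) ^ Z := pow_nonneg (hc0.trans hcle) Z
    calc c ^ Z * q = 1 * (c ^ Z * q) := (one_mul _).symm
      _ ≤ Real.sqrt E * ((2 * Real.cos (φ / 2)) ^ Z
          * ((2 * φ / (Real.pi * D)) ^ D * (D.factorial : ℝ) / (D + 1))) :=
          mul_le_mul h3 (mul_le_mul h1 hqle hq0 h4) (by positivity) (by positivity)
  have hL0R : c ^ Z * q ≤ R := hL0.trans hlaw
  have hL00 : 0 ≤ c ^ Z * q := by positivity
  have hsq : (c ^ Z * q) ^ 2 = c ^ (2 * Z) * q ^ 2 := by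
    rw [mul_pow, pow_right_comm c Z 2, ← pow_mul]
  rw [← hsq]
  exact pow_le_pow_left₀ hL00 hL0R 2

/-- GENERIC `2×2` INTERPOLATION ROW: the rational certificate
`(2K²H²)² < (2−φ²/4)^{2Z}·((2φ/(3.1416·D))^D·D!/(D+1))²` at some rational `0 < φ ≤ 3/2` excludes every pencil
of `K` real `2×2` letters of height `≤ H`, ends `|c₀·lc| ≥ 1`, `Z` distinct positive roots and degree `Z + D`. -/
theorem irow2 {K Z D : ℕ} (φ H : ℝ) (hD1 : 1 ≤ D) (hφ0 : 0 < φ) (hφ1 : φ ≤ 3 / 2)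
    (hnum : (2 * ((K : ℝ) * H) ^ 2) ^ 2
      < (2 - φ ^ 2 / 4) ^ (2 * Z) * ((2 * φ / (3.1416 * D)) ^ D * (D.factorial : ℝ) / (D + 1)) ^ 2)
    (d : Fin K → ℕ) (S : Fin K → Matrix (Fin 2) (Fin 2) ℝ) (hS : ∀ l i j, |S l i j| ≤ H)
    (A : Finset ℝ) (hA : A.card = Z) (hApos : ∀ a ∈ A, 0 < a)
    (hAroot : ∀ a ∈ A, (pencil d S).det.IsRoot a) (hdeg : (pencil d S).det.natDegree = Z + D)
    (hE : 1 ≤ |(pencil d S).det.coeff 0 * (pencil d S).det.leadingCoeff|) : False := by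
  have hdet : (pencil d S).det ≠ 0 := by
    intro h0; rw [h0, natDegree_zero] at hdeg; omega
  have h0 : (pencil d S).det.coeff 0 ≠ 0 := by
    intro h0; rw [h0, zero_mul, abs_zero] at hE; linarith
  have hφ : φ ≤ Real.pi / 2 := by linarith [Real.pi_gt_three]
  have hlaw := pencilInterpolationLaw d S hS hdet h0 A hApos hAroot (D := D) (by rw [hdeg, hA]) hD1 hφ0 hφ
  rw [hA] at hlaw
  have hlaw' : Real.sqrt |(pencil d S).det.coeff 0 * (pencil d S).det.leadingCoeff|
      * ((2 * Real.cos (φ / 2)) ^ Z * ((2 * φ / (Real.pi * D)) ^ D * (D.factorial : ℝ) / (D + 1)))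
      ≤ 2 * ((K : ℝ) * H) ^ 2 := by
    have : ((Nat.factorial 2 : ℕ) : ℝ) = 2 := by norm_num [Nat.factorial]
    simpa [this] using hlaw
  have := irow_core hD1 hφ0 hφ1 hE hlaw'
  linarith

/-! ### Interpolation rows, `(2,8)` with 26 positive roots: `D=3 ⇒ h ≥ 23`, `4 ⇒ ≥ 9`, `5 ⇒ ≥ 4`, `6 ⇒ ≥ 2`. -/

/-- Interpolation row at `(2,8)`: no pencil of 8 real `2×2` letters of height `≤ 22` with ends `|c₀·lc| ≥ 1` has 26 distinct positive roots of `det` and degree `26 + 3` (rational certificate at `φ = 33/50`). -/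
theorem irow_8_26_3 (d : Fin 8 → ℕ) (S : Fin 8 → Matrix (Fin 2) (Fin 2) ℝ) (hS : ∀ l i j, |S l i j| ≤ 22)
    (A : Finset ℝ) (hA : A.card = 26) (hApos : ∀ a ∈ A, 0 < a)
    (hAroot : ∀ a ∈ A, (pencil d S).det.IsRoot a) (hdeg : (pencil d S).det.natDegree = 26 + 3)
    (hE : 1 ≤ |(pencil d S).det.coeff 0 * (pencil d S).det.leadingCoeff|) : False :=
  irow2 (K := 8) (Z := 26) (D := 3) (33/50 : ℝ) 22 (by norm_num) (by norm_num) (by norm_num)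
    (by norm_num [Nat.factorial]) d S hS A hA hApos hAroot hdeg hE

/-- Interpolation row at `(2,8)`: no pencil of 8 real `2×2` letters of height `≤ 8` with ends `|c₀·lc| ≥ 1` has 26 distinct positive roots of `det` and degree `26 + 4` (rational certificate at `φ = 19/25`). -/
theorem irow_8_26_4 (d : Fin 8 → ℕ) (S : Fin 8 → Matrix (Fin 2) (Fin 2) ℝ) (hS : ∀ l i j, |S l i j| ≤ 8)
    (A : Finset ℝ) (hA : A.card = 26) (hApos : ∀ a ∈ A, 0 < a)
    (hAroot : ∀ a ∈ A, (pencil d S).det.IsRoot a) (hdeg : (pencil d S).det.natDegree = 26 + 4)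
    (hE : 1 ≤ |(pencil d S).det.coeff 0 * (pencil d S).det.leadingCoeff|) : False :=
  irow2 (K := 8) (Z := 26) (D := 4) (19/25 : ℝ) 8 (by norm_num) (by norm_num) (by norm_num)
    (by norm_num [Nat.factorial]) d S hS A hA hApos hAroot hdeg hE

/-- Interpolation row at `(2,8)`: no pencil of 8 real `2×2` letters of height `≤ 3` with ends `|c₀·lc| ≥ 1` has 26 distinct positive roots of `det` and degree `26 + 5` (rational certificate at `φ = 21/25`). -/
theorem irow_8_26_5 (d : Fin 8 → ℕ) (S : Fin 8 → Matrix (Fin 2) (Fin 2) ℝ) (hS : ∀ l i j, |S l i j| ≤ 3)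
    (A : Finset ℝ) (hA : A.card = 26) (hApos : ∀ a ∈ A, 0 < a)
    (hAroot : ∀ a ∈ A, (pencil d S).det.IsRoot a) (hdeg : (pencil d S).det.natDegree = 26 + 5)
    (hE : 1 ≤ |(pencil d S).det.coeff 0 * (pencil d S).det.leadingCoeff|) : False :=
  irow2 (K := 8) (Z := 26) (D := 5) (21/25 : ℝ) 3 (by norm_num) (by norm_num) (by norm_num)
    (by norm_num [Nat.factorial]) d S hS A hA hApos hAroot hdeg hE

/-- Interpolation row at `(2,8)`: no pencil of 8 real `2×2` letters of height `≤ 1` with ends `|c₀·lc| ≥ 1` has 26 distinct positive roots of `det` and degree `26 + 6` (rational certificate at `φ = 91/100`). -/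
theorem irow_8_26_6 (d : Fin 8 → ℕ) (S : Fin 8 → Matrix (Fin 2) (Fin 2) ℝ) (hS : ∀ l i j, |S l i j| ≤ 1)
    (A : Finset ℝ) (hA : A.card = 26) (hApos : ∀ a ∈ A, 0 < a)
    (hAroot : ∀ a ∈ A, (pencil d S).det.IsRoot a) (hdeg : (pencil d S).det.natDegree = 26 + 6)
    (hE : 1 ≤ |(pencil d S).det.coeff 0 * (pencil d S).det.leadingCoeff|) : False :=
  irow2 (K := 8) (Z := 26) (D := 6) (91/100 : ℝ) 1 (by norm_num) (by norm_num) (by norm_num)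
    (by norm_num [Nat.factorial]) d S hS A hA hApos hAroot hdeg hE

/-! ### Interpolation rows, `(2,9)` with 32 positive roots: `D=3 ⇒ ≥ 138 · 4 ⇒ ≥ 51 · 5 ⇒ ≥ 21 · 6 ⇒ ≥ 9 · 7 ⇒ ≥ 4 · 8 ⇒ ≥ 2`. -/

/-- Interpolation row at `(2,9)`: no pencil of 9 real `2×2` letters of height `≤ 137` with ends `|c₀·lc| ≥ 1` has 32 distinct positive roots of `det` and degree `32 + 3` (rational certificate at `φ = 3/5`). -/
theorem irow_9_32_3 (d : Fin 9 → ℕ) (S : Fin 9 → Matrix (Fin 2) (Fin 2) ℝ) (hS : ∀ l i j, |S l i j| ≤ 137)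
    (A : Finset ℝ) (hA : A.card = 32) (hApos : ∀ a ∈ A, 0 < a)
    (hAroot : ∀ a ∈ A, (pencil d S).det.IsRoot a) (hdeg : (pencil d S).det.natDegree = 32 + 3)
    (hE : 1 ≤ |(pencil d S).det.coeff 0 * (pencil d S).det.leadingCoeff|) : False :=
  irow2 (K := 9) (Z := 32) (D := 3) (3/5 : ℝ) 137 (by norm_num) (by norm_num) (by norm_num)
    (by norm_num [Nat.factorial]) d S hS A hA hApos hAroot hdeg hE

/-- Interpolation row at `(2,9)`: no pencil of 9 real `2×2` letters of height `≤ 50` with ends `|c₀·lc| ≥ 1` has 32 distinct positive roots of `det` and degree `32 + 4` (rational certificate at `φ = 69/100`). -/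
theorem irow_9_32_4 (d : Fin 9 → ℕ) (S : Fin 9 → Matrix (Fin 2) (Fin 2) ℝ) (hS : ∀ l i j, |S l i j| ≤ 50)
    (A : Finset ℝ) (hA : A.card = 32) (hApos : ∀ a ∈ A, 0 < a)
    (hAroot : ∀ a ∈ A, (pencil d S).det.IsRoot a) (hdeg : (pencil d S).det.natDegree = 32 + 4)
    (hE : 1 ≤ |(pencil d S).det.coeff 0 * (pencil d S).det.leadingCoeff|) : False :=
  irow2 (K := 9) (Z := 32) (D := 4) (69/100 : ℝ) 50 (by norm_num) (by norm_num) (by norm_num)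
    (by norm_num [Nat.factorial]) d S hS A hA hApos hAroot hdeg hE

/-- Interpolation row at `(2,9)`: no pencil of 9 real `2×2` letters of height `≤ 20` with ends `|c₀·lc| ≥ 1` has 32 distinct positive roots of `det` and degree `32 + 5` (rational certificate at `φ = 19/25`). -/
theorem irow_9_32_5 (d : Fin 9 → ℕ) (S : Fin 9 → Matrix (Fin 2) (Fin 2) ℝ) (hS : ∀ l i j, |S l i j| ≤ 20)
    (A : Finset ℝ) (hA : A.card = 32) (hApos : ∀ a ∈ A, 0 < a)
    (hAroot : ∀ a ∈ A, (pencil d S).det.IsRoot a) (hdeg : (pencil d S).det.natDegree = 32 + 5)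
    (hE : 1 ≤ |(pencil d S).det.coeff 0 * (pencil d S).det.leadingCoeff|) : False :=
  irow2 (K := 9) (Z := 32) (D := 5) (19/25 : ℝ) 20 (by norm_num) (by norm_num) (by norm_num)
    (by norm_num [Nat.factorial]) d S hS A hA hApos hAroot hdeg hE

/-- Interpolation row at `(2,9)`: no pencil of 9 real `2×2` letters of height `≤ 8` with ends `|c₀·lc| ≥ 1` has 32 distinct positive roots of `det` and degree `32 + 6` (rational certificate at `φ = 83/100`). -/
theorem irow_9_32_6 (d : Fin 9 → ℕ) (S : Fin 9 → Matrix (Fin 2) (Fin 2) ℝ) (hS : ∀ l i j, |S l i j| ≤ 8)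
    (A : Finset ℝ) (hA : A.card = 32) (hApos : ∀ a ∈ A, 0 < a)
    (hAroot : ∀ a ∈ A, (pencil d S).det.IsRoot a) (hdeg : (pencil d S).det.natDegree = 32 + 6)
    (hE : 1 ≤ |(pencil d S).det.coeff 0 * (pencil d S).det.leadingCoeff|) : False :=
  irow2 (K := 9) (Z := 32) (D := 6) (83/100 : ℝ) 8 (by norm_num) (by norm_num) (by norm_num)
    (by norm_num [Nat.factorial]) d S hS A hA hApos hAroot hdeg hE

/-- Interpolation row at `(2,9)`: no pencil of 9 real `2×2` letters of height `≤ 3` with ends `|c₀·lc| ≥ 1` has 32 distinct positive roots of `det` and degree `32 + 7` (rational certificate at `φ = 89/100`). -/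
theorem irow_9_32_7 (d : Fin 9 → ℕ) (S : Fin 9 → Matrix (Fin 2) (Fin 2) ℝ) (hS : ∀ l i j, |S l i j| ≤ 3)
    (A : Finset ℝ) (hA : A.card = 32) (hApos : ∀ a ∈ A, 0 < a)
    (hAroot : ∀ a ∈ A, (pencil d S).det.IsRoot a) (hdeg : (pencil d S).det.natDegree = 32 + 7)
    (hE : 1 ≤ |(pencil d S).det.coeff 0 * (pencil d S).det.leadingCoeff|) : False :=
  irow2 (K := 9) (Z := 32) (D := 7) (89/100 : ℝ) 3 (by norm_num) (by norm_num) (by norm_num)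
    (by norm_num [Nat.factorial]) d S hS A hA hApos hAroot hdeg hE

/-- Interpolation row at `(2,9)`: no pencil of 9 real `2×2` letters of height `≤ 1` with ends `|c₀·lc| ≥ 1` has 32 distinct positive roots of `det` and degree `32 + 8` (rational certificate at `φ = 47/50`). -/
theorem irow_9_32_8 (d : Fin 9 → ℕ) (S : Fin 9 → Matrix (Fin 2) (Fin 2) ℝ) (hS : ∀ l i j, |S l i j| ≤ 1)
    (A : Finset ℝ) (hA : A.card = 32) (hApos : ∀ a ∈ A, 0 < a)
    (hAroot : ∀ a ∈ A, (pencil d S).det.IsRoot a) (hdeg : (pencil d S).det.natDegree = 32 + 8)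
    (hE : 1 ≤ |(pencil d S).det.coeff 0 * (pencil d S).det.leadingCoeff|) : False :=
  irow2 (K := 9) (Z := 32) (D := 8) (47/50 : ℝ) 1 (by norm_num) (by norm_num) (by norm_num)
    (by norm_num [Nat.factorial]) d S hS A hA hApos hAroot hdeg hE

/-! ### Interpolation rows, `(2,7)` with 20 positive roots: `D=3 ⇒ ≥ 4 · 4 ⇒ ≥ 2`. -/

/-- Interpolation row at `(2,7)`: no pencil of 7 real `2×2` letters of height `≤ 3` with ends `|c₀·lc| ≥ 1` has 20 distinct positive roots of `det` and degree `20 + 3` (rational certificate at `φ = 3/4`). -/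
theorem irow_7_20_3 (d : Fin 7 → ℕ) (S : Fin 7 → Matrix (Fin 2) (Fin 2) ℝ) (hS : ∀ l i j, |S l i j| ≤ 3)
    (A : Finset ℝ) (hA : A.card = 20) (hApos : ∀ a ∈ A, 0 < a)
    (hAroot : ∀ a ∈ A, (pencil d S).det.IsRoot a) (hdeg : (pencil d S).det.natDegree = 20 + 3)
    (hE : 1 ≤ |(pencil d S).det.coeff 0 * (pencil d S).det.leadingCoeff|) : False :=
  irow2 (K := 7) (Z := 20) (D := 3) (3/4 : ℝ) 3 (by norm_num) (by norm_num) (by norm_num)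
    (by norm_num [Nat.factorial]) d S hS A hA hApos hAroot hdeg hE

/-- Interpolation row at `(2,7)`: no pencil of 7 real `2×2` letters of height `≤ 1` with ends `|c₀·lc| ≥ 1` has 20 distinct positive roots of `det` and degree `20 + 4` (rational certificate at `φ = 17/20`). -/
theorem irow_7_20_4 (d : Fin 7 → ℕ) (S : Fin 7 → Matrix (Fin 2) (Fin 2) ℝ) (hS : ∀ l i j, |S l i j| ≤ 1)
    (A : Finset ℝ) (hA : A.card = 20) (hApos : ∀ a ∈ A, 0 < a)
    (hAroot : ∀ a ∈ A, (pencil d S).det.IsRoot a) (hdeg : (pencil d S).det.natDegree = 20 + 4)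
    (hE : 1 ≤ |(pencil d S).det.coeff 0 * (pencil d S).det.leadingCoeff|) : False :=
  irow2 (K := 7) (Z := 20) (D := 4) (17/20 : ℝ) 1 (by norm_num) (by norm_num) (by norm_num)
    (by norm_num [Nat.factorial]) d S hS A hA hApos hAroot hdeg hE

/-! ## §10 Positive packaging for citation by name (crit-1 VERDICT #25 port note) -/

-- `NearFullHeightRow K Z D H` is the `NearFullHeightRow` of (DD), cited by name.

/-- `NearFullHeightRow K Z D H` is monotone in the height bound: it persists for every `H' ≤ H`. -/
theorem nearFullHeightRow_mono {K Z D : ℕ} {H H' : ℝ} (hH : H' ≤ H) (h : NearFullHeightRow K Z D H) :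
    NearFullHeightRow K Z D H' :=
  fun d S hS A hA hApos hAroot hdeg hE => h d S (fun l i j => (hS l i j).trans hH) A hA hApos hAroot hdeg hE

/-! The table (best of §6/§9 per cell): `(2,8)`, Z=26: D=1…6 ↦ H = 292, 84, 22, 8, 3, 1;
`(2,9)`, Z=32: D=1…8 ↦ 1980, 542, 137, 50, 20, 8, 3, 1; `(2,7)`, Z=20: D=1…4 ↦ 44, 13, 3, 1; `(2,6)`, Z=16: D=1,2 ↦ 13, 4.
(`NearFullHeightRow K Z D H` = «entries ≤ H impossible», so the minimal admissible integer height is `H+1`.) -/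

/-- Packaged near-full height row `(6, 16, 1)`: by `defectRow_6_16_1` (pigeonhole law, `row2`). -/
theorem nearFullHeightRow_6_16_1 : NearFullHeightRow 6 16 1 13 :=
  fun d S hS A hA hApos hAroot hdeg hE => defectRow_6_16_1 d S hS A hA hApos hAroot hdeg hE

/-- Packaged near-full height row `(6, 16, 2)`: by `defectRow_6_16_2` (pigeonhole law, `row2`). -/
theorem nearFullHeightRow_6_16_2 : NearFullHeightRow 6 16 2 4 :=
  fun d S hS A hA hApos hAroot hdeg hE => defectRow_6_16_2 d S hS A hA hApos hAroot hdeg hE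

/-- Packaged near-full height row `(7, 20, 1)`: by `defectRow_7_20_1` (pigeonhole law, `row2`). -/
theorem nearFullHeightRow_7_20_1 : NearFullHeightRow 7 20 1 44 :=
  fun d S hS A hA hApos hAroot hdeg hE => defectRow_7_20_1 d S hS A hA hApos hAroot hdeg hE

/-- Packaged near-full height row `(7, 20, 2)`: by `defectRow_7_20_2` (pigeonhole law, `row2`). -/
theorem nearFullHeightRow_7_20_2 : NearFullHeightRow 7 20 2 13 :=
  fun d S hS A hA hApos hAroot hdeg hE => defectRow_7_20_2 d S hS A hA hApos hAroot hdeg hE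

/-- Packaged near-full height row `(7, 20, 3)`: by `irow_7_20_3` (interpolation law, `irow2`). -/
theorem nearFullHeightRow_7_20_3 : NearFullHeightRow 7 20 3 3 :=
  fun d S hS A hA hApos hAroot hdeg hE => irow_7_20_3 d S hS A hA hApos hAroot hdeg hE

/-- Packaged near-full height row `(7, 20, 4)`: by `irow_7_20_4` (interpolation law, `irow2`). -/
theorem nearFullHeightRow_7_20_4 : NearFullHeightRow 7 20 4 1 :=
  fun d S hS A hA hApos hAroot hdeg hE => irow_7_20_4 d S hS A hA hApos hAroot hdeg hE

/-- Packaged near-full height row `(8, 26, 1)`: by `defectRow_8_26_1` (pigeonhole law, `row2`). -/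
theorem nearFullHeightRow_8_26_1 : NearFullHeightRow 8 26 1 292 :=
  fun d S hS A hA hApos hAroot hdeg hE => defectRow_8_26_1 d S hS A hA hApos hAroot hdeg hE

/-- Packaged near-full height row `(8, 26, 2)`: by `defectRow_8_26_2` (pigeonhole law, `row2`). -/
theorem nearFullHeightRow_8_26_2 : NearFullHeightRow 8 26 2 84 :=
  fun d S hS A hA hApos hAroot hdeg hE => defectRow_8_26_2 d S hS A hA hApos hAroot hdeg hE

/-- Packaged near-full height row `(8, 26, 3)`: by `irow_8_26_3` (interpolation law, `irow2`). -/
theorem nearFullHeightRow_8_26_3 : NearFullHeightRow 8 26 3 22 :=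
  fun d S hS A hA hApos hAroot hdeg hE => irow_8_26_3 d S hS A hA hApos hAroot hdeg hE

/-- Packaged near-full height row `(8, 26, 4)`: by `irow_8_26_4` (interpolation law, `irow2`). -/
theorem nearFullHeightRow_8_26_4 : NearFullHeightRow 8 26 4 8 :=
  fun d S hS A hA hApos hAroot hdeg hE => irow_8_26_4 d S hS A hA hApos hAroot hdeg hE

/-- Packaged near-full height row `(8, 26, 5)`: by `irow_8_26_5` (interpolation law, `irow2`). -/
theorem nearFullHeightRow_8_26_5 : NearFullHeightRow 8 26 5 3 :=
  fun d S hS A hA hApos hAroot hdeg hE => irow_8_26_5 d S hS A hA hApos hAroot hdeg hE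

/-- Packaged near-full height row `(8, 26, 6)`: by `irow_8_26_6` (interpolation law, `irow2`). -/
theorem nearFullHeightRow_8_26_6 : NearFullHeightRow 8 26 6 1 :=
  fun d S hS A hA hApos hAroot hdeg hE => irow_8_26_6 d S hS A hA hApos hAroot hdeg hE

/-- Packaged near-full height row `(9, 32, 1)`: by `defectRow_9_32_1` (pigeonhole law, `row2`). -/
theorem nearFullHeightRow_9_32_1 : NearFullHeightRow 9 32 1 1980 :=
  fun d S hS A hA hApos hAroot hdeg hE => defectRow_9_32_1 d S hS A hA hApos hAroot hdeg hE

/-- Packaged near-full height row `(9, 32, 2)`: by `defectRow_9_32_2` (pigeonhole law, `row2`). -/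
theorem nearFullHeightRow_9_32_2 : NearFullHeightRow 9 32 2 542 :=
  fun d S hS A hA hApos hAroot hdeg hE => defectRow_9_32_2 d S hS A hA hApos hAroot hdeg hE

/-- Packaged near-full height row `(9, 32, 3)`: by `irow_9_32_3` (interpolation law, `irow2`). -/
theorem nearFullHeightRow_9_32_3 : NearFullHeightRow 9 32 3 137 :=
  fun d S hS A hA hApos hAroot hdeg hE => irow_9_32_3 d S hS A hA hApos hAroot hdeg hE

/-- Packaged near-full height row `(9, 32, 4)`: by `irow_9_32_4` (interpolation law, `irow2`). -/
theorem nearFullHeightRow_9_32_4 : NearFullHeightRow 9 32 4 50 :=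
  fun d S hS A hA hApos hAroot hdeg hE => irow_9_32_4 d S hS A hA hApos hAroot hdeg hE

/-- Packaged near-full height row `(9, 32, 5)`: by `irow_9_32_5` (interpolation law, `irow2`). -/
theorem nearFullHeightRow_9_32_5 : NearFullHeightRow 9 32 5 20 :=
  fun d S hS A hA hApos hAroot hdeg hE => irow_9_32_5 d S hS A hA hApos hAroot hdeg hE

/-- Packaged near-full height row `(9, 32, 6)`: by `irow_9_32_6` (interpolation law, `irow2`). -/
theorem nearFullHeightRow_9_32_6 : NearFullHeightRow 9 32 6 8 :=
  fun d S hS A hA hApos hAroot hdeg hE => irow_9_32_6 d S hS A hA hApos hAroot hdeg hE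

/-- Packaged near-full height row `(9, 32, 7)`: by `irow_9_32_7` (interpolation law, `irow2`). -/
theorem nearFullHeightRow_9_32_7 : NearFullHeightRow 9 32 7 3 :=
  fun d S hS A hA hApos hAroot hdeg hE => irow_9_32_7 d S hS A hA hApos hAroot hdeg hE

/-- Packaged near-full height row `(9, 32, 8)`: by `irow_9_32_8` (interpolation law, `irow2`). -/
theorem nearFullHeightRow_9_32_8 : NearFullHeightRow 9 32 8 1 :=
  fun d S hS A hA hApos hAroot hdeg hE => irow_9_32_8 d S hS A hA hApos hAroot hdeg hE

end Summit.ValiantsHypothesis.ValiantsHypothesis.Theorems.LacunarySymmetroidMatrixDescartes.Defect
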